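import Summits.HubbardSuperconductivity.HubbardSuperconductivity.Theorems.ChiralWindowCwChannelInfContinuousChemicalPotential
import HarnessLib

/-!
# Route `ChiralWindow`, crux `CwThesis` (stmt-HubbardSuperconductivity-10438), line `SketchIdeator3` v6:
# the `U`-free certificate at a band LEVEL

The registered certificate stub of the line (`stub_klCertificate`, consumed by
`cwThesis_of_klCanonical_of_klCertificate`, file `ChiralWindowCwThesisUFreeAnchor.lean`) is stated at the chemical potential
`μ_δ₀ = chemicalPotentialOfDensity ε (1 - δ₀)` of a window doping `δ₀ ∈ [3/10, 12/25]` (`ε = squareDispersion 1 0`). A certified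
computation works the other way round (`Cruxes/CwKLChiralWindow/CertSpec.md` §1): it fixes a RATIONAL band level `μ₀ ∈ (-4,0)`,
certifies the channel-bottom inequalities there, and encloses the free-band filling `n(μ₀)` coarsely. This file records the
bridge: since `μ(n(μ₀)) = μ₀` EXACTLY (`chemicalPotentialOfDensity_eq_of_filling_eq`, the `sInf` is a genuine inverse of the
strictly increasing filling), a certificate at the level `μ₀` with `1 - n(μ₀) ∈ [3/10, 12/25]` IS a certificate at the window
doping `δ₀ := 1 - n(μ₀)`:

* `klCertificate_of_certificateAtLevel` (registered on the crux as a stub of the lead skeleton) — for the sharp (mean-zero `A1g`)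
  certificate; `certificateOne_of_certificateOneAtLevel` — for the cruder `U = 1` certificate;
* with `cwThesis_of_klCanonical_of_klCertificate` (file `ChiralWindowCwThesisUFreeAnchor.lean`) this gives the anchor in level form:
  `KLCanonical → (certificate at some level μ₀ with 1 - n(μ₀) in the window) → CwThesis` (one-line composition, left to the user).

No definitions; nothing here is certified numerics. [folklore]
-/

noncomputable section

-- the tree's namespace repeats the summit name by design (D-0017)
set_option linter.dupNamespace false

namespace Summit.HubbardSuperconductivity.HubbardSuperconductivity.Theorems.CwThesis

open MeasureTheory Real Set Filter
open Literature.MathematicalPhysics.QuantumLattice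
open Summit.HubbardSuperconductivity.HubbardSuperconductivity.Theses

/-- **The certificate at a band LEVEL gives the certificate at a window DOPING.** If the `U`-free inequalities hold at some
level `μ₀ ∈ (-4,0)` whose free-band filling `n(μ₀)` has `1 - n(μ₀) ∈ [3/10, 12/25]`, they hold at `μ_δ₀` for the window doping
`δ₀ := 1 - n(μ₀)`, because `μ(n(μ₀)) = μ₀` exactly (`chemicalPotentialOfDensity_eq_of_filling_eq`). This is how a certified
computation meets the `chemicalPotentialOfDensity` in the stub: certify at a RATIONAL level and enclose its filling coarsely
(`Cruxes/CwKLChiralWindow/CertSpec.md` §1). [folklore] -/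
theorem klCertificate_of_certificateAtLevel
    (h : ∃ μ₀ ∈ Set.Ioo (-4 : ℝ) 0,
      1 - KohnLuttinger.filling (squareDispersion 1 0) μ₀ ∈ Set.Icc (3/10 : ℝ) (12/25) ∧ ∃ γ : ℝ, 0 < γ ∧
      (∀ χ : D4Irrep, χ ≠ D4Irrep.B1g → χ ≠ D4Irrep.A1g →
        channelInf (squareDispersion 1 0) μ₀ 1 D4Irrep.B1g + γ ≤ channelInf (squareDispersion 1 0) μ₀ 1 χ) ∧
      (∀ φ : Momentum → ℝ, IsChannelState (squareDispersion 1 0) μ₀ D4Irrep.A1g φ →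
        ∫ k, φ k ∂fermiCurveMeasure (squareDispersion 1 0) μ₀ = 0 →
          channelInf (squareDispersion 1 0) μ₀ 1 D4Irrep.B1g + γ ≤ pairingForm (squareDispersion 1 0) μ₀ 1 φ)) :
    ∃ δ₀ ∈ Set.Icc (3/10 : ℝ) (12/25), ∃ γ : ℝ, 0 < γ ∧
      (∀ χ : D4Irrep, χ ≠ D4Irrep.B1g → χ ≠ D4Irrep.A1g →
        channelInf (squareDispersion 1 0) (chemicalPotentialOfDensity (squareDispersion 1 0) (1 - δ₀)) 1 D4Irrep.B1g + γ ≤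
          channelInf (squareDispersion 1 0) (chemicalPotentialOfDensity (squareDispersion 1 0) (1 - δ₀)) 1 χ) ∧
      (∀ φ : Momentum → ℝ,
        IsChannelState (squareDispersion 1 0) (chemicalPotentialOfDensity (squareDispersion 1 0) (1 - δ₀)) D4Irrep.A1g φ →
        ∫ k, φ k ∂fermiCurveMeasure (squareDispersion 1 0) (chemicalPotentialOfDensity (squareDispersion 1 0) (1 - δ₀)) = 0 →
          channelInf (squareDispersion 1 0) (chemicalPotentialOfDensity (squareDispersion 1 0) (1 - δ₀)) 1 D4Irrep.B1g + γ ≤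
            pairingForm (squareDispersion 1 0) (chemicalPotentialOfDensity (squareDispersion 1 0) (1 - δ₀)) 1 φ) := by
  obtain ⟨μ₀, hμ₀, hwin, γ, hγ, hoff, hA⟩ := h
  set n₀ := KohnLuttinger.filling (squareDispersion 1 0) μ₀ with hn₀
  have hn0 : 0 < n₀ := by linarith [hwin.2]
  have hμeq : chemicalPotentialOfDensity (squareDispersion 1 0) (1 - (1 - n₀)) = μ₀ := by
    rw [sub_sub_cancel]
    exact chemicalPotentialOfDensity_eq_of_filling_eq hn0 ⟨by linarith [hμ₀.1], by linarith [hμ₀.2]⟩ rfl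
  refine ⟨1 - n₀, hwin, γ, hγ, ?_, ?_⟩
  · rw [hμeq]; exact hoff
  · rw [hμeq]; exact hA

/-- The same bridge for the cruder `U = 1` certificate. [folklore] -/
theorem certificateOne_of_certificateOneAtLevel
    (h : ∃ μ₀ ∈ Set.Ioo (-4 : ℝ) 0,
      1 - KohnLuttinger.filling (squareDispersion 1 0) μ₀ ∈ Set.Icc (3/10 : ℝ) (12/25) ∧ ∃ γ : ℝ, 0 < γ ∧
      ∀ χ : D4Irrep, χ ≠ D4Irrep.B1g →
        channelInf (squareDispersion 1 0) μ₀ 1 D4Irrep.B1g + γ ≤ channelInf (squareDispersion 1 0) μ₀ 1 χ) :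
    ∃ δ₀ ∈ Set.Icc (3/10 : ℝ) (12/25), ∃ γ : ℝ, 0 < γ ∧ ∀ χ : D4Irrep, χ ≠ D4Irrep.B1g →
      channelInf (squareDispersion 1 0) (chemicalPotentialOfDensity (squareDispersion 1 0) (1 - δ₀)) 1 D4Irrep.B1g + γ ≤
        channelInf (squareDispersion 1 0) (chemicalPotentialOfDensity (squareDispersion 1 0) (1 - δ₀)) 1 χ := by
  obtain ⟨μ₀, hμ₀, hwin, γ, hγ, hcert⟩ := h
  set n₀ := KohnLuttinger.filling (squareDispersion 1 0) μ₀ with hn₀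
  have hn0 : 0 < n₀ := by linarith [hwin.2]
  have hμeq : chemicalPotentialOfDensity (squareDispersion 1 0) (1 - (1 - n₀)) = μ₀ := by
    rw [sub_sub_cancel]
    exact chemicalPotentialOfDensity_eq_of_filling_eq hn0 ⟨by linarith [hμ₀.1], by linarith [hμ₀.2]⟩ rfl
  refine ⟨1 - n₀, hwin, γ, hγ, ?_⟩
  rw [hμeq]; exact hcert

end Summit.HubbardSuperconductivity.HubbardSuperconductivity.Theorems.CwThesis

end
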